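import Literature.Analysis.FluidPDE.FluidComputer.PointGroupMasks
import Literature.Analysis.FluidPDE.FluidComputer.SpaceGroupSymmetry
import HarnessLib

/-!
# Selection rules of the classical runs: the axis and diagonal wavevectors of a Kida–Pelz run carry no energy at any time, so below `|k|² = 19` only the shells `|k|² = 8` and `11` can ever be occupied

PLACEMENT: cell-own bookkeeping of `pub-fluidc` (topic `FluidComputer`; `Literature/` holds cited published
statements only). Companion of `KidaPelzBirth` (where the datum FIRST sends energy, at second order) — this
file says where it can NEVER send energy, at any order and any time, in exact arithmetic.
HONEST FRAMING (cell `pub-fluidc`, verbatim): *low prior, high value-of-information experiment on Tao's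
machine paradigm; NOT a claim that NS blows up.* Finite Galerkin system, exact arithmetic; nothing about
the Navier–Stokes PDE.

THE THREE RULES along every unforced Galerkin solution (any `ν`, any pressure multiplier) supported in the
engines' cubic mask `Dealiasing.box K` through the Kida–Pelz datum `kp`: (parity, already typed:
`ShellTransfer.kp_mixedParity_zero`) mixed-parity wavevectors have `û(k,t) = 0`; (AXES, new: `kp_axis_zero_box`)
`û((n,0,0),t) = û((0,n,0),t) = û((0,0,n),t) = 0`, `n ≠ 0` — the mirrors `x ↦ -x`, `y ↦ -y`, `z ↦ -z` fix the
datum (`KidaPelzHat.reflX/Y/Z_act_kp`) and persist (`LatticeIsometry.act_eq_self_box`); an axis wavevector is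
fixed by the two mirrors transverse to it, which reverse the two transverse components of `û(k)`, and the
longitudinal component vanishes by incompressibility; (DIAGONALS, new: `kp_diag_zero_box`) `û((±n,±n,±n),t) = 0`,
`n ≠ 0` — the 3-cycle fixes the datum (`KidaPelzHat.cycleXYZ_act_kp`) and `(n,n,n)` and cycles the components of
`û(n,n,n)`, which is then a multiple of `(1,1,1) ∥ k`, killed by incompressibility; other signs are mirror images.
CONSEQUENCE (`kp_coeff_eq_zero_below_19`, `kp_modalEnergy_eq_zero_below_19`; the finite case analysis
`uniformParity_cases` is kernel-decided): for `0 < |k|² ≤ 18`, `|k|² ∉ {8, 11}`, `û(k,t) = 0` — in the engines'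
isotropic integer bins (`round |k|`) BINS 1 AND 2 OF EVERY CL-kp ENERGY SPECTRUM ARE IDENTICALLY ZERO FOR ALL
TIMES, bin 3 holds only the shells `|k|² = 8` and `11` (the datum) and bin 4 only `|k|² = 19, 20`; whatever a run
shows in bins 1–2 is round-off, i.e. the size of its symmetry-breaking perturbation (the cell's double-precision
CL-kp runs, both engines: `≤ 2.5e-32` at all output times through `t = 1.9`; single precision `≤ 2.4e-16`).
Taylor–Green: the axis rule holds too (`tg_axis_zero_box`; the three mirrors fix `tg`), so below `|k|² = 8` only
the datum shell `|k|² = 3` is occupied (`tg_coeff_eq_zero_below_8`).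
PRINTED ANCHOR. In the Kida representation `v_x = u(x,y,z)`, `v_y = u(y,z,x)`, `v_z = u(z,x,y)`,
`u = Σ a_lmn(t) sin lx cos my cos nz` with "`(l ≠ 0)` … `(l, m, n)` all odd or even; … `l a_lmn + m a_mnl + n a_nlm
= 0`" [cite: NgBhattacharjee2002, eqs. (2)–(3)] both new rules are one-line corollaries (`N a_N00 = 0`;
`3N a_NNN = 0`); this file does not assume that representation but derives the rules for the Galerkin system on
the engines' mask from the persistence of the mirrors and the 3-cycle plus incompressibility. Consequences of
typed symmetries; 0 sorry, 0 named facts (D-0026).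
-/

noncomputable section

namespace Summit.NavierStokesRegularity.FluidComputer

open Complex ComplexConjugate Finset
open scoped BigOperators
open Literature.Analysis.FluidPDE.FluidComputer Literature.Analysis.FluidPDE.FluidComputer.ShellTransfer

namespace KidaPelzSelectionRules

/-! ## Coefficient formulas of the mirrors `y ↦ -y`, `z ↦ -z` and of the 3-cycle (`x ↦ -x` is
`ShellTransfer.reflX_act_coeff_eq`) -/

/-- The coefficients of `reflY · A`: `(û₀, −û₁, û₂)(k₀, −k₁, k₂)`. -/
theorem reflY_act_coeff_eq (A : FourierVelocity) (k : Fin 3 → ℤ) :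
    (reflY.act A).coeff k =
      ![A.coeff (reflY.invK k) 0, -(A.coeff (reflY.invK k) 1), A.coeff (reflY.invK k) 2] := by
  funext i
  rw [LatticeIsometry.act_coeff]
  unfold reflY
  fin_cases i <;> simp [Fin.sum_univ_three]

/-- The coefficients of `reflZ · A`: `(û₀, û₁, −û₂)(k₀, k₁, −k₂)`. -/
theorem reflZ_act_coeff_eq (A : FourierVelocity) (k : Fin 3 → ℤ) :
    (reflZ.act A).coeff k =
      ![A.coeff (reflZ.invK k) 0, A.coeff (reflZ.invK k) 1, -(A.coeff (reflZ.invK k) 2)] := by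
  funext i
  rw [LatticeIsometry.act_coeff]
  unfold reflZ
  fin_cases i <;> simp [Fin.sum_univ_three]

/-- The coefficients of `cycleXYZ · A`: `(û₂, û₀, û₁)(k₁, k₂, k₀)`. -/
theorem cycleXYZ_act_coeff_eq (A : FourierVelocity) (k : Fin 3 → ℤ) :
    (cycleXYZ.act A).coeff k =
      ![A.coeff (cycleXYZ.invK k) 2, A.coeff (cycleXYZ.invK k) 0, A.coeff (cycleXYZ.invK k) 1] := by
  funext i
  rw [LatticeIsometry.act_coeff]
  unfold cycleXYZ
  fin_cases i <;> simp [Fin.sum_univ_three]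

/-! ## Static rules: what an invariant divergence-free field cannot carry -/

/-- A `reflX`-invariant field has no `x`-component on the plane `k₀ = 0`. -/
theorem coeff_zero_eq_zero_of_reflX {A : FourierVelocity} (h : reflX.act A = A) {k : Fin 3 → ℤ}
    (hk : k 0 = 0) : A.coeff k 0 = 0 := by
  have hinv : reflX.invK k = k := by
    rw [reflX_invK]; funext i; fin_cases i <;> simp [hk]
  have hc : A.coeff k 0 = -(A.coeff k 0) := by
    conv_lhs => rw [← h]
    rw [reflX_act_coeff_eq, hinv]
    simp
  have h2 : (2 : ℂ) * A.coeff k 0 = 0 := by linear_combination hc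
  simpa using h2

/-- A `reflY`-invariant field has no `y`-component on the plane `k₁ = 0`. -/
theorem coeff_one_eq_zero_of_reflY {A : FourierVelocity} (h : reflY.act A = A) {k : Fin 3 → ℤ}
    (hk : k 1 = 0) : A.coeff k 1 = 0 := by
  have hinv : reflY.invK k = k := by
    rw [reflY_invK]; funext i; fin_cases i <;> simp [hk]
  have hc : A.coeff k 1 = -(A.coeff k 1) := by
    conv_lhs => rw [← h]
    rw [reflY_act_coeff_eq, hinv]
    simp
  have h2 : (2 : ℂ) * A.coeff k 1 = 0 := by linear_combination hc
  simpa using h2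

/-- A `reflZ`-invariant field has no `z`-component on the plane `k₂ = 0`. -/
theorem coeff_two_eq_zero_of_reflZ {A : FourierVelocity} (h : reflZ.act A = A) {k : Fin 3 → ℤ}
    (hk : k 2 = 0) : A.coeff k 2 = 0 := by
  have hinv : reflZ.invK k = k := by
    rw [reflZ_invK]; funext i; fin_cases i <;> simp [hk]
  have hc : A.coeff k 2 = -(A.coeff k 2) := by
    conv_lhs => rw [← h]
    rw [reflZ_act_coeff_eq, hinv]
    simp
  have h2 : (2 : ℂ) * A.coeff k 2 = 0 := by linear_combination hc
  simpa using h2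

/-- Incompressibility at a wavevector with two vanishing components of `û(k)`: the third vanishes too if
its entry of `k` is nonzero. -/
theorem coeff_eq_zero_of_divFree (A : FourierVelocity) {k : Fin 3 → ℤ} {i : Fin 3} (hki : k i ≠ 0)
    (h : ∀ j, j ≠ i → A.coeff k j = 0) : A.coeff k i = 0 := by
  have hd := A.divFree k
  rw [Finset.sum_eq_single i (fun j _ hj => by rw [h j hj, mul_zero])
    (fun hi => absurd (Finset.mem_univ i) hi)] at hd
  rcases mul_eq_zero.mp hd with hz | hz
  · exact absurd (by exact_mod_cast hz) hki
  · exact hz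

/-- **AXIS RULE, `x`-axis**: a field invariant under `y ↦ -y` and `z ↦ -z` vanishes at every `(n,0,0)`,
`n ≠ 0` (stated on components: `k₁ = k₂ = 0`, `k₀ ≠ 0`). -/
theorem axisX_zero {A : FourierVelocity} (hY : reflY.act A = A) (hZ : reflZ.act A = A) {k : Fin 3 → ℤ}
    (h1 : k 1 = 0) (h2 : k 2 = 0) (h0 : k 0 ≠ 0) : A.coeff k = 0 := by
  have c1 := coeff_one_eq_zero_of_reflY hY h1
  have c2 := coeff_two_eq_zero_of_reflZ hZ h2
  have c0 : A.coeff k 0 = 0 := by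
    refine coeff_eq_zero_of_divFree A h0 fun j hj => ?_
    fin_cases j <;> first | exact absurd rfl hj | assumption
  funext i; fin_cases i <;> assumption

/-- **AXIS RULE, `y`-axis** (mirrors `x ↦ -x`, `z ↦ -z`). -/
theorem axisY_zero {A : FourierVelocity} (hX : reflX.act A = A) (hZ : reflZ.act A = A) {k : Fin 3 → ℤ}
    (h0 : k 0 = 0) (h2 : k 2 = 0) (h1 : k 1 ≠ 0) : A.coeff k = 0 := by
  have c0 := coeff_zero_eq_zero_of_reflX hX h0
  have c2 := coeff_two_eq_zero_of_reflZ hZ h2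
  have c1 : A.coeff k 1 = 0 := by
    refine coeff_eq_zero_of_divFree A h1 fun j hj => ?_
    fin_cases j <;> first | exact absurd rfl hj | assumption
  funext i; fin_cases i <;> assumption

/-- **AXIS RULE, `z`-axis** (mirrors `x ↦ -x`, `y ↦ -y`). -/
theorem axisZ_zero {A : FourierVelocity} (hX : reflX.act A = A) (hY : reflY.act A = A) {k : Fin 3 → ℤ}
    (h0 : k 0 = 0) (h1 : k 1 = 0) (h2 : k 2 ≠ 0) : A.coeff k = 0 := by
  have c0 := coeff_zero_eq_zero_of_reflX hX h0
  have c1 := coeff_one_eq_zero_of_reflY hY h1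
  have c2 : A.coeff k 2 = 0 := by
    refine coeff_eq_zero_of_divFree A h2 fun j hj => ?_
    fin_cases j <;> first | exact absurd rfl hj | assumption
  funext i; fin_cases i <;> assumption

/-- **DIAGONAL RULE**: a field invariant under the coordinate 3-cycle vanishes at every `(n,n,n)`, `n ≠ 0`:
invariance makes `û(n,n,n)` a multiple of `(1,1,1) ∥ k`, and incompressibility kills it. -/
theorem diag_zero {A : FourierVelocity} (hC : cycleXYZ.act A = A) {k : Fin 3 → ℤ} (h1 : k 1 = k 0)
    (h2 : k 2 = k 0) (h0 : k 0 ≠ 0) : A.coeff k = 0 := by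
  have hinv : cycleXYZ.invK k = k := by
    rw [cycleXYZ_invK]; funext i; fin_cases i <;> simp [h1, h2]
  have hc : A.coeff k = ![A.coeff k 2, A.coeff k 0, A.coeff k 1] := by
    conv_lhs => rw [← hC]
    rw [cycleXYZ_act_coeff_eq, hinv]
  have e0 : A.coeff k 0 = A.coeff k 2 := by simpa using congrFun hc 0
  have e1 : A.coeff k 1 = A.coeff k 0 := by simpa using congrFun hc 1
  have hd := A.divFree k
  simp only [Fin.sum_univ_three, h1, h2] at hd
  have h3 : (3 * ((k 0 : ℤ) : ℂ)) * A.coeff k 0 = 0 := by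
    linear_combination hd - ((k 0 : ℤ) : ℂ) * e1 + ((k 0 : ℤ) : ℂ) * e0
  have hk3 : (3 * ((k 0 : ℤ) : ℂ)) ≠ 0 := mul_ne_zero (by norm_num) (by exact_mod_cast h0)
  have c0 : A.coeff k 0 = 0 := (mul_eq_zero.mp h3).resolve_left hk3
  funext i; fin_cases i
  · exact c0
  · exact e1.trans c0
  · simpa [c0] using e0.symm

/-- The diagonal `(-n, n, n)`: its mirror image under `x ↦ -x` is `(n,n,n)`. -/
theorem diagX_zero {A : FourierVelocity} (hX : reflX.act A = A) (hC : cycleXYZ.act A = A) {k : Fin 3 → ℤ}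
    (h0 : k 0 = -k 1) (h2 : k 2 = k 1) (h1 : k 1 ≠ 0) : A.coeff k = 0 := by
  have hz : A.coeff (reflX.invK k) = 0 := by
    rw [reflX_invK]
    exact diag_zero hC (by simp [h0]) (by simp [h0, h2]) (by simpa [h0] using h1)
  calc A.coeff k = (reflX.act A).coeff k := by rw [hX]
    _ = 0 := by rw [reflX_act_coeff_eq, hz]; funext i; fin_cases i <;> simp

/-- The diagonal `(n, -n, n)`: its mirror image under `y ↦ -y` is `(n,n,n)`. -/
theorem diagY_zero {A : FourierVelocity} (hY : reflY.act A = A) (hC : cycleXYZ.act A = A) {k : Fin 3 → ℤ}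
    (h1 : k 1 = -k 0) (h2 : k 2 = k 0) (h0 : k 0 ≠ 0) : A.coeff k = 0 := by
  have hz : A.coeff (reflY.invK k) = 0 := by
    rw [reflY_invK]
    exact diag_zero hC (by simp [h1]) (by simp [h2]) (by simpa using h0)
  calc A.coeff k = (reflY.act A).coeff k := by rw [hY]
    _ = 0 := by rw [reflY_act_coeff_eq, hz]; funext i; fin_cases i <;> simp

/-- The diagonal `(n, n, -n)`: its mirror image under `z ↦ -z` is `(n,n,n)`. -/
theorem diagZ_zero {A : FourierVelocity} (hZ : reflZ.act A = A) (hC : cycleXYZ.act A = A) {k : Fin 3 → ℤ}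
    (h1 : k 1 = k 0) (h2 : k 2 = -k 0) (h0 : k 0 ≠ 0) : A.coeff k = 0 := by
  have hz : A.coeff (reflZ.invK k) = 0 := by
    rw [reflZ_invK]
    exact diag_zero hC (by simp [h1]) (by simp [h2]) (by simpa using h0)
  calc A.coeff k = (reflZ.act A).coeff k := by rw [hZ]
    _ = 0 := by rw [reflZ_act_coeff_eq, hz]; funext i; fin_cases i <;> simp

/-! ## The finite case analysis: a nonzero uniform-parity wavevector with `|k|² ≤ 18`, `|k|² ≠ 8, 11`, lies on
an axis or a diagonal (kernel-decided over the box `|kᵢ| ≤ 4`) -/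

/-- The decidable mirror of the case analysis, over explicit entry lists. -/
theorem cases_mir : ∀ x ∈ ([-4, -3, -2, -1, 0, 1, 2, 3, 4] : List ℤ), ∀ y ∈ ([-4, -3, -2, -1, 0, 1, 2, 3, 4] : List ℤ),
    ∀ z ∈ ([-4, -3, -2, -1, 0, 1, 2, 3, 4] : List ℤ),
      (¬(x = 0 ∧ y = 0 ∧ z = 0) ∧ (x % 2 = y % 2 ∧ x % 2 = z % 2) ∧ x ^ 2 + y ^ 2 + z ^ 2 ≤ 18 ∧
          x ^ 2 + y ^ 2 + z ^ 2 ≠ 8 ∧ x ^ 2 + y ^ 2 + z ^ 2 ≠ 11) →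
        (y = 0 ∧ z = 0) ∨ (x = 0 ∧ z = 0) ∨ (x = 0 ∧ y = 0) ∨ (y = x ∧ z = x) ∨ (x = -y ∧ z = y) ∨
          (y = -x ∧ z = x) ∨ (y = x ∧ z = -x) := by
  decide +kernel

/-- The bookkeeping shared by the KP and TG case analyses: a nonzero uniform-parity wavevector with
`|k|² ≤ 18` has entries in the list `[-4, …, 4]`, not all zero, of equal residues mod 2. -/
theorem entries_prelim {k : Fin 3 → ℤ} (hk0 : k ≠ 0) (hp : UniformParity k)
    (h18 : k 0 ^ 2 + k 1 ^ 2 + k 2 ^ 2 ≤ 18) :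
    ¬(k 0 = 0 ∧ k 1 = 0 ∧ k 2 = 0) ∧ (k 0 % 2 = k 1 % 2 ∧ k 0 % 2 = k 2 % 2) ∧
      ∀ i, k i ∈ ([-4, -3, -2, -1, 0, 1, 2, 3, 4] : List ℤ) := by
  refine ⟨?_, ?_, ?_⟩
  · rintro ⟨a, b, c⟩
    exact hk0 (funext fun i => by fin_cases i <;> assumption)
  · unfold UniformParity at hp
    simp only [Int.even_iff] at hp
    omega
  · have b0 : k 0 ≤ 4 ∧ -4 ≤ k 0 := by constructor <;> nlinarith [sq_nonneg (k 1), sq_nonneg (k 2)]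
    have b1 : k 1 ≤ 4 ∧ -4 ≤ k 1 := by constructor <;> nlinarith [sq_nonneg (k 0), sq_nonneg (k 2)]
    have b2 : k 2 ≤ 4 ∧ -4 ≤ k 2 := by constructor <;> nlinarith [sq_nonneg (k 0), sq_nonneg (k 1)]
    intro i
    simp only [List.mem_cons, List.not_mem_nil, or_false]
    fin_cases i <;> simp only [Fin.zero_eta, Fin.mk_one, Fin.reduceFinMk] <;> omega

/-- **Below `|k|² = 19`, off the shells `8` and `11`, a nonzero uniform-parity wavevector is an axis or a
diagonal wavevector.** -/
theorem uniformParity_cases {k : Fin 3 → ℤ} (hk0 : k ≠ 0) (hp : UniformParity k) (h18 : ∑ i, k i ^ 2 ≤ 18)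
    (h8 : ∑ i, k i ^ 2 ≠ 8) (h11 : ∑ i, k i ^ 2 ≠ 11) :
    (k 1 = 0 ∧ k 2 = 0) ∨ (k 0 = 0 ∧ k 2 = 0) ∨ (k 0 = 0 ∧ k 1 = 0) ∨ (k 1 = k 0 ∧ k 2 = k 0) ∨
      (k 0 = -k 1 ∧ k 2 = k 1) ∨ (k 1 = -k 0 ∧ k 2 = k 0) ∨ (k 1 = k 0 ∧ k 2 = -k 0) := by
  simp only [Fin.sum_univ_three] at h18 h8 h11
  obtain ⟨hne, hpar, hm⟩ := entries_prelim hk0 hp h18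
  exact cases_mir (k 0) (hm 0) (k 1) (hm 1) (k 2) (hm 2) ⟨hne, hpar, h18, h8, h11⟩

/-- The TG case analysis: a nonzero uniform-parity wavevector with `|k|² ≤ 7`, `|k|² ≠ 3`, is an axis
wavevector (kernel-decided over `|kᵢ| ≤ 4`). -/
theorem cases_mir_tg : ∀ x ∈ ([-4, -3, -2, -1, 0, 1, 2, 3, 4] : List ℤ),
    ∀ y ∈ ([-4, -3, -2, -1, 0, 1, 2, 3, 4] : List ℤ), ∀ z ∈ ([-4, -3, -2, -1, 0, 1, 2, 3, 4] : List ℤ),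
      (¬(x = 0 ∧ y = 0 ∧ z = 0) ∧ (x % 2 = y % 2 ∧ x % 2 = z % 2) ∧ x ^ 2 + y ^ 2 + z ^ 2 ≤ 7 ∧
          x ^ 2 + y ^ 2 + z ^ 2 ≠ 3) →
        (y = 0 ∧ z = 0) ∨ (x = 0 ∧ z = 0) ∨ (x = 0 ∧ y = 0) := by
  decide +kernel

/-- An axis-or-diagonal wavevector (as produced by `uniformParity_cases`) of a nonzero `k` is killed by a
field with the three mirror symmetries and the 3-cycle symmetry. -/
theorem coeff_eq_zero_of_cases {A : FourierVelocity} (hX : reflX.act A = A) (hY : reflY.act A = A)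
    (hZ : reflZ.act A = A) (hC : cycleXYZ.act A = A) {k : Fin 3 → ℤ} (hk0 : k ≠ 0)
    (h : (k 1 = 0 ∧ k 2 = 0) ∨ (k 0 = 0 ∧ k 2 = 0) ∨ (k 0 = 0 ∧ k 1 = 0) ∨ (k 1 = k 0 ∧ k 2 = k 0) ∨
      (k 0 = -k 1 ∧ k 2 = k 1) ∨ (k 1 = -k 0 ∧ k 2 = k 0) ∨ (k 1 = k 0 ∧ k 2 = -k 0)) :
    A.coeff k = 0 := by
  have hne : ¬(k 0 = 0 ∧ k 1 = 0 ∧ k 2 = 0) := by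
    rintro ⟨a, b, c⟩
    exact hk0 (funext fun i => by fin_cases i <;> assumption)
  rcases h with ⟨a, b⟩ | ⟨a, b⟩ | ⟨a, b⟩ | ⟨a, b⟩ | ⟨a, b⟩ | ⟨a, b⟩ | ⟨a, b⟩
  · exact axisX_zero hY hZ a b (by omega)
  · exact axisY_zero hX hZ a b (by omega)
  · exact axisZ_zero hX hY a b (by omega)
  · exact diag_zero hC a b (by omega)
  · exact diagX_zero hX hC a b (by omega)
  · exact diagY_zero hY hC a b (by omega)
  · exact diagZ_zero hZ hC a b (by omega)

/-! ## Kida–Pelz runs on the engines' mask -/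

section KP

variable {K : ℕ} {U : ℝ → FourierVelocity} {ν : ℝ} {c : ℝ → (Fin 3 → ℤ) → ℂ}
  (hU : IsGalerkinSolution U (Dealiasing.box K) ν c fun _ _ _ => 0) (hs : IsSupportedOn U (Dealiasing.box K))
  {t₀ : ℝ} (h0 : U t₀ = KidaPelzHat.kp)
include hU hs h0

/-- The mirror `x ↦ -x` persists along Kida–Pelz runs on the cubic mask, no side condition. -/
theorem kp_reflX_persists_box (t : ℝ) : reflX.act (U t) = U t :=
  reflX.act_eq_self_box hU hs (by rw [h0, KidaPelzHat.reflX_act_kp]) t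

/-- The mirror `y ↦ -y` persists. -/
theorem kp_reflY_persists_box (t : ℝ) : reflY.act (U t) = U t :=
  reflY.act_eq_self_box hU hs (by rw [h0, KidaPelzHat.reflY_act_kp]) t

/-- The mirror `z ↦ -z` persists. -/
theorem kp_reflZ_persists_box (t : ℝ) : reflZ.act (U t) = U t :=
  reflZ.act_eq_self_box hU hs (by rw [h0, KidaPelzHat.reflZ_act_kp]) t

/-- **KP AXIS RULE**: `û((n,0,0),t) = û((0,n,0),t) = û((0,0,n),t) = 0` for all `t` and `n ≠ 0`. -/
theorem kp_axis_zero_box (t : ℝ) {n : ℤ} (hn : n ≠ 0) :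
    (U t).coeff ![n, 0, 0] = 0 ∧ (U t).coeff ![0, n, 0] = 0 ∧ (U t).coeff ![0, 0, n] = 0 :=
  ⟨axisX_zero (kp_reflY_persists_box hU hs h0 t) (kp_reflZ_persists_box hU hs h0 t) rfl rfl (by simpa using hn),
    axisY_zero (kp_reflX_persists_box hU hs h0 t) (kp_reflZ_persists_box hU hs h0 t) rfl rfl (by simpa using hn),
    axisZ_zero (kp_reflX_persists_box hU hs h0 t) (kp_reflY_persists_box hU hs h0 t) rfl rfl (by simpa using hn)⟩

/-- **KP DIAGONAL RULE**: `û((±n,±n,±n),t) = 0` for all `t` and `n ≠ 0` (the four sign classes; the other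
four are these with `-n`). -/
theorem kp_diag_zero_box (t : ℝ) {n : ℤ} (hn : n ≠ 0) :
    (U t).coeff ![n, n, n] = 0 ∧ (U t).coeff ![-n, n, n] = 0 ∧ (U t).coeff ![n, -n, n] = 0 ∧
      (U t).coeff ![n, n, -n] = 0 :=
  ⟨diag_zero (kp_cycleXYZ_persists_box hU hs h0 t) rfl rfl (by simpa using hn),
    diagX_zero (kp_reflX_persists_box hU hs h0 t) (kp_cycleXYZ_persists_box hU hs h0 t) rfl rfl
      (by simpa using hn),
    diagY_zero (kp_reflY_persists_box hU hs h0 t) (kp_cycleXYZ_persists_box hU hs h0 t) rfl rfl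
      (by simpa using hn),
    diagZ_zero (kp_reflZ_persists_box hU hs h0 t) (kp_cycleXYZ_persists_box hU hs h0 t) rfl rfl
      (by simpa using hn)⟩

/-- **BELOW `|k|² = 19` ONLY THE SHELLS `|k|² = 8` AND `11` CAN BE OCCUPIED IN A KIDA–PELZ RUN**: every other
nonzero wavevector with `|k|² ≤ 18` has `û(k,t) = 0` at all times (mixed parity, axis or diagonal). -/
theorem kp_coeff_eq_zero_below_19 (t : ℝ) {k : Fin 3 → ℤ} (hk0 : k ≠ 0) (h18 : ∑ i, k i ^ 2 ≤ 18)
    (h8 : ∑ i, k i ^ 2 ≠ 8) (h11 : ∑ i, k i ^ 2 ≠ 11) : (U t).coeff k = 0 := by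
  by_cases hp : UniformParity k
  · exact coeff_eq_zero_of_cases (kp_reflX_persists_box hU hs h0 t) (kp_reflY_persists_box hU hs h0 t)
      (kp_reflZ_persists_box hU hs h0 t) (kp_cycleXYZ_persists_box hU hs h0 t) hk0
      (uniformParity_cases hk0 hp h18 h8 h11)
  · exact kp_mixedParity_zero hU hs h0 t hp

/-- In particular **the isotropic bins 1 and 2 (`0 < |k|² ≤ 6`) of a Kida–Pelz run are empty at all times.** -/
theorem kp_coeff_eq_zero_of_le_six (t : ℝ) {k : Fin 3 → ℤ} (hk0 : k ≠ 0) (h6 : ∑ i, k i ^ 2 ≤ 6) :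
    (U t).coeff k = 0 :=
  kp_coeff_eq_zero_below_19 hU hs h0 t hk0 (by omega) (by omega) (by omega)

/-- The same in energy: `E(k,t) = 0` below `|k|² = 19` off the shells `8` and `11`. -/
theorem kp_modalEnergy_eq_zero_below_19 (t : ℝ) {k : Fin 3 → ℤ} (hk0 : k ≠ 0) (h18 : ∑ i, k i ^ 2 ≤ 18)
    (h8 : ∑ i, k i ^ 2 ≠ 8) (h11 : ∑ i, k i ^ 2 ≠ 11) : modalEnergy (U t) k = 0 :=
  modalEnergy_eq_zero_of_coeff _ (kp_coeff_eq_zero_below_19 hU hs h0 t hk0 h18 h8 h11)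

end KP

/-! ## Taylor–Green runs on the engines' mask: the axis rule, and below `|k|² = 8` only the datum shell -/

section TG

variable {K : ℕ} {U : ℝ → FourierVelocity} {ν : ℝ} {c : ℝ → (Fin 3 → ℤ) → ℂ}
  (hU : IsGalerkinSolution U (Dealiasing.box K) ν c fun _ _ _ => 0) (hs : IsSupportedOn U (Dealiasing.box K))
  {t₀ : ℝ} (h0 : U t₀ = TaylorGreenHat.tg)
include hU hs h0

/-- The mirror `y ↦ -y` persists along Taylor–Green runs on the cubic mask (`x ↦ -x`:
`ShellTransfer.tg_reflX_persists_box`). -/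
theorem tg_reflY_persists_box (t : ℝ) : reflY.act (U t) = U t :=
  reflY.act_eq_self_box hU hs (by rw [h0, reflY_act_tg]) t

/-- The mirror `z ↦ -z` persists. -/
theorem tg_reflZ_persists_box (t : ℝ) : reflZ.act (U t) = U t :=
  reflZ.act_eq_self_box hU hs (by rw [h0, reflZ_act_tg]) t

/-- **TG AXIS RULE**: `û((n,0,0),t) = û((0,n,0),t) = û((0,0,n),t) = 0` for all `t` and `n ≠ 0`. -/
theorem tg_axis_zero_box (t : ℝ) {n : ℤ} (hn : n ≠ 0) :
    (U t).coeff ![n, 0, 0] = 0 ∧ (U t).coeff ![0, n, 0] = 0 ∧ (U t).coeff ![0, 0, n] = 0 :=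
  ⟨axisX_zero (tg_reflY_persists_box hU hs h0 t) (tg_reflZ_persists_box hU hs h0 t) rfl rfl (by simpa using hn),
    axisY_zero (tg_reflX_persists_box hU hs h0 t) (tg_reflZ_persists_box hU hs h0 t) rfl rfl
      (by simpa using hn),
    axisZ_zero (tg_reflX_persists_box hU hs h0 t) (tg_reflY_persists_box hU hs h0 t) rfl rfl
      (by simpa using hn)⟩

/-- **BELOW `|k|² = 8` ONLY THE DATUM SHELL `|k|² = 3` IS OCCUPIED IN A TAYLOR–GREEN RUN.** -/
theorem tg_coeff_eq_zero_below_8 (t : ℝ) {k : Fin 3 → ℤ} (hk0 : k ≠ 0) (h7 : ∑ i, k i ^ 2 ≤ 7)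
    (h3 : ∑ i, k i ^ 2 ≠ 3) : (U t).coeff k = 0 := by
  by_cases hp : UniformParity k
  · simp only [Fin.sum_univ_three] at h7 h3
    obtain ⟨hne, hpar, hm⟩ := entries_prelim hk0 hp (by omega)
    have hX := tg_reflX_persists_box hU hs h0 t
    have hY := tg_reflY_persists_box hU hs h0 t
    have hZ := tg_reflZ_persists_box hU hs h0 t
    rcases cases_mir_tg (k 0) (hm 0) (k 1) (hm 1) (k 2) (hm 2) ⟨hne, hpar, h7, h3⟩ with ⟨a, b⟩ | ⟨a, b⟩ | ⟨a, b⟩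
    · exact axisX_zero hY hZ a b (by omega)
    · exact axisY_zero hX hZ a b (by omega)
    · exact axisZ_zero hX hY a b (by omega)
  · exact tg_mixedParity_zero hU hs h0 t hp

/-- The same in energy. -/
theorem tg_modalEnergy_eq_zero_below_8 (t : ℝ) {k : Fin 3 → ℤ} (hk0 : k ≠ 0) (h7 : ∑ i, k i ^ 2 ≤ 7)
    (h3 : ∑ i, k i ^ 2 ≠ 3) : modalEnergy (U t) k = 0 :=
  modalEnergy_eq_zero_of_coeff _ (tg_coeff_eq_zero_below_8 hU hs h0 t hk0 h7 h3)

end TG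

end KidaPelzSelectionRules

end Summit.NavierStokesRegularity.FluidComputer

end
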